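import Literature.NumberTheory.Rogawski1990.AdelicStableOrbitalIntegral
import Literature.NumberTheory.Automorphic.AdeleRingTopology
import Literature.LinearAlgebra.Matrix.RegularSemisimpleConjClassClosed
import HarnessLib

/-!
# Only finitely many REGULAR stable classes of `U(H)(L⁺)` have an adelic matching class meeting a compact subset of `U(Φ₃)(𝔸)`
(Rogawski (1990), §3.1 p. 19, §3.3 p. 21, §4.3 p. 44, §5.4 (5.4.3) pp. 72–73: in `Σ_{𝒪} Σ_{δ ∈ 𝒞_𝐀(𝒪)} Φ(δ, f)` «the sum is finite»; Kottwitz (1986) §7)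

Topic `NumberTheory/Rogawski1990`; namespace `Literature.NumberTheory.Rogawski1990`.  THEOREMS ONLY: no definition, no instance, no named fact, no `sorry`.
Cell `pub/hodgecm-mathlib`, ENGINE T1, ED 1.19c pin (xii-f) «`∀ f, (Function.support fun 𝒪 => 𝔨.SJG 𝒪 f).Finite`» (row (SF-st), F0P3a-plan (g4) GO #88 (c) ∕
GO #89 (2′)).  ★ `AdelicStableOrbitalSupportFinite` proves finiteness INSIDE one adelic stable class `𝒞_𝐀(γ₀)` (finitely many `G(𝐀)`-classes meet a
compact set, under [Kt₄] Prop. 7.1).  This file proves finiteness ACROSS the stable classes, with NO arithmetic input: the road is the characteristic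
polynomial through the adele ring.

* §1 (generic linear algebra over a field `K`): `charpoly_eq_of_isConj_units` (conjugate invertible matrices have the same characteristic polynomial);
  `isConj_of_charpoly_eq_of_separable` (two invertible matrices with the same SEPARABLE characteristic polynomial are conjugate in `GL_m(K)` — both are
  non-derogatory, ★ `minpoly_eq_charpoly_of_charpoly_separable`, and non-derogatory matrices with equal characteristic polynomial are similar, ★
  `exists_conj_eq_of_minpoly_eq_charpoly` [HornJohnson2013, 3.3.P12]); hence **`stableClassOf_eq_of_charpoly_eq`**: `StableClass.charpoly` is INJECTIVE on
  the REGULAR stable classes (stable conjugacy in `U(H)(F)` is `GL_n(L)`-conjugacy, ★ `StableConjugacyU3`).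
* §2 (`G = U(Φ₃)` over a CM field `L`, `γ₀ ∈ U(H)(L⁺)`): **`MatchingAdeleG.algebraMap_coeff_charpoly`** — for a matching adèle `p` over `γ₀` and every `k`,
  `ι((p_{γ₀}).coeff k) = (p_{p.adele}).coeff k` in `𝔸_L` (`ι : L → 𝔸_L` the diagonal embedding): at the finite places from ★ `MatchingAdeleG.corresponds_toLocal`
  (conjugacy in `GL₃(∏_{w∣v} L_w)`, read at the component `w`), at infinity from ★ `MatchingAdeleG.corresponds_arch` (conjugacy in `GL₃(L ⊗ ℝ)`, pulled back
  along Mathlib's `InfiniteAdeleRing.ringEquiv_mixedSpace`); `continuous_coeff_charpoly_adelic` (★ `continuous_charpoly_coeff`).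
* §3 **`finite_setOf_stableClass_meets`** — for `C ⊆ U(Φ₃)(𝔸_L)` compact, the set of stable classes `𝒪 = 𝒪_st(γ₀)`, `γ₀` REGULAR, such that some class of
  `𝒞_𝐀(γ₀) = MatchingAdeleG.classes L H γ₀` meets `C`, is FINITE: `𝒪 ↦ p_𝒪` is injective on them (§1) and each coefficient `(p_{γ₀}).coeff k`, `k ≤ 3`, lies
  in the finite set `{ξ ∈ L : ι(ξ) ∈ (coeff_k ∘ charpoly) '' C}` (`finite_setOf_algebraMap_mem_of_isCompact`: `L` is discrete and closed in `𝔸_L`, ★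
  `AdeleRing.discreteTopology_principalSubgroup`; the same statement as ★ `AdeleRing.finite_setOf_algebraMap_mem` of `GL2RationalBorelFiniteness`, re-derived in
  ten lines to keep the `GL₂` trace-formula modules out of the T1 import cone).
* §4 **`finite_setOf_stableClass_adelicStableOrbitalIntegralG_ne_zero`** — hence for EVERY family `m` of orbital measures on the adelic classes and every `f`
  with compact support, only finitely many regular stable classes `𝒪_st(γ₀)` have `Φ^{st,𝐀}_G(γ₀, m, f) ≠ 0` (a non-zero `finsum` has a non-zero term, and
  `Φ(δ, f) ≠ 0` forces `[δ]` to meet `tsupport f`, ★ `orbitalIntegral_eq_zero_of_forall_notMem_tsupport`).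
HC_CM is proved only modulo the printed citations until rung 0 closes; this file proves no printed citation (elementary adelic plumbing).

## References
* [Rogawski1990] J. D. Rogawski, *Automorphic Representations of Unitary Groups in Three Variables*, Ann. of Math. Stud. 123 (1990), §3.1 p. 19, §3.3 p. 21,
  §4.3 p. 44, §5.4 pp. 72–73.
* [Kottwitz1986] R. E. Kottwitz, *Stable trace formula: elliptic singular terms*, Math. Ann. 275 (1986), §7.
* [HornJohnson2013] R. A. Horn, C. R. Johnson, *Matrix Analysis*, 2nd ed. (2013), 3.3.P12.
* [CasselsFrohlichANT1967] J. W. S. Cassels, A. Fröhlich (eds.), *Algebraic Number Theory* (1967), Ch. II §14 (discreteness of `K` in `𝔸_K`).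
-/

set_option autoImplicit false

noncomputable section

open NumberField IsDedekindDomain Filter Function MeasureTheory Polynomial
open scoped MatrixGroups

namespace Literature.NumberTheory.Rogawski1990

open Literature.NumberTheory.Automorphic Literature.MeasureTheory.Group
open Literature.AlgebraicGeometry.ShimuraVarieties (unitaryGroup)

/-! ## §1 Regular semisimple classes are determined by their characteristic polynomial -/

section LinearAlgebra

/-- Conjugate invertible matrices have the same characteristic polynomial. [cite: HornJohnson2013, Thm 1.3.3] -/
theorem charpoly_eq_of_isConj_units {R : Type*} [CommRing R] {n : Type*} [Fintype n] [DecidableEq n] {g h : GL n R}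
    (hc : IsConj g h) : (g : Matrix n n R).charpoly = (h : Matrix n n R).charpoly := by
  obtain ⟨c, hc⟩ := isConj_iff.mp hc
  rw [← hc, Units.val_mul, Units.val_mul, Matrix.coe_units_inv, Matrix.charpoly_units_conj]

/-- **Two invertible matrices over a field with the same SEPARABLE characteristic polynomial are conjugate in `GL_m(K)`**: a matrix with separable
characteristic polynomial is non-derogatory (★ `minpoly_eq_charpoly_of_charpoly_separable`), and two non-derogatory matrices with the same characteristic
polynomial are similar (★ `exists_conj_eq_of_minpoly_eq_charpoly`, both being similar to the companion matrix). [cite: HornJohnson2013, 3.3.P12] -/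
theorem isConj_of_charpoly_eq_of_separable {K : Type*} [Field K] {m : ℕ} (γ δ : GL (Fin m) K)
    (hγ : ((γ : Matrix (Fin m) (Fin m) K).charpoly).Separable)
    (h : (γ : Matrix (Fin m) (Fin m) K).charpoly = (δ : Matrix (Fin m) (Fin m) K).charpoly) : IsConj γ δ := by
  have hδ : ((δ : Matrix (Fin m) (Fin m) K).charpoly).Separable := h ▸ hγ
  obtain ⟨S, hS, hSe⟩ := Literature.LinearAlgebra.Matrix.exists_conj_eq_of_minpoly_eq_charpoly (γ : Matrix (Fin m) (Fin m) K) δ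
    (Literature.LinearAlgebra.Matrix.minpoly_eq_charpoly_of_charpoly_separable _ hγ)
    (Literature.LinearAlgebra.Matrix.minpoly_eq_charpoly_of_charpoly_separable _ hδ) h
  have hSu : IsUnit S := (Matrix.isUnit_iff_isUnit_det S).mpr hS
  refine isConj_iff.mpr ⟨hSu.unit⁻¹, Units.ext ?_⟩
  rw [Units.val_mul, Units.val_mul, inv_inv, Matrix.coe_units_inv, IsUnit.unit_spec, hSe]

/-- **`StableClass.charpoly` is injective on the REGULAR stable classes**: if `γ` is regular and `p_δ = p_γ` then `𝒪_st(δ) = 𝒪_st(γ)` — stable conjugacy in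
`U(H)(F) ≤ GL_m(K)` is conjugacy in `GL_m(K)` (★ `StableConjugacyU3`), and §1's rigidity applies. [cite: Rogawski1990, §3.1 p. 19] [cite: HornJohnson2013, 3.3.P12] -/
theorem stableClassOf_eq_of_charpoly_eq {K : Type*} [Field K] {m : ℕ} {σ : K →+* K} {J : Matrix (Fin m) (Fin m) K}
    {γ δ : unitaryGroup σ J} (hreg : IsRegularElt (γ.val : GL (Fin m) K))
    (h : ((δ.val : GL (Fin m) K) : Matrix (Fin m) (Fin m) K).charpoly = ((γ.val : GL (Fin m) K) : Matrix (Fin m) (Fin m) K).charpoly) :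
    stableClassOf σ J δ = stableClassOf σ J γ :=
  stableClassOf_eq_iff.mpr (isConj_of_charpoly_eq_of_separable _ _ (h ▸ hreg) h)

/-- Hence `𝒪 ↦ 𝒪.charpoly` is injective on `{𝒪 | 𝒪 = 𝒪_st(γ) for some regular γ}`. [cite: Rogawski1990, §3.1 p. 19] -/
theorem injOn_charpoly_setOf_regular {K : Type*} [Field K] {m : ℕ} {σ : K →+* K} {J : Matrix (Fin m) (Fin m) K} :
    Set.InjOn (StableClass.charpoly (σ := σ) (H := J))
      {𝒪 : StableClass σ J | ∃ γ : unitaryGroup σ J, stableClassOf σ J γ = 𝒪 ∧ IsRegularElt (γ.val : GL (Fin m) K)} := by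
  rintro 𝒪 ⟨γ, rfl, hγ⟩ 𝒪' ⟨γ', rfl, -⟩ h
  rw [StableClass.charpoly_stableClassOf, StableClass.charpoly_stableClassOf] at h
  exact (stableClassOf_eq_of_charpoly_eq hγ h.symm).symm

end LinearAlgebra

/-! ## §2 The characteristic polynomial of a matching adèle is the rational one, diagonally embedded in `𝔸_L[X]` -/

section Charpoly

variable {L : Type} [Field L] [NumberField L] [IsCMField L] {H : Matrix (Fin 3) (Fin 3) L}
  {γ₀ : (UnitaryGroup.cmDatum L 3 H).Rational}

/-- At a finite place `v` of `L⁺`: the characteristic polynomial of the `v`-component of a matching adèle is that of `(γ₀)_v` — both read in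
`GL₃(∏_{w∣v} L_w)` (★ `MatchingAdeleG.corresponds_toLocal`: the two are conjugate there). [cite: Rogawski1990, §14.1 p. 232] -/
theorem MatchingAdeleG.charpoly_map_adeleToLocal (p : MatchingAdeleG L H γ₀) (v : HeightOneSpectrum (𝓞 ↥(maximalRealSubfield L))) :
    ((p.adele.val : GL (Fin 3) (AdeleRing (𝓞 L) L)) : Matrix (Fin 3) (Fin 3) (AdeleRing (𝓞 L) L)).charpoly.map
        (UnitaryGroup.adeleToLocal L v) =
      (((γ₀.val : GL (Fin 3) L) : Matrix (Fin 3) (Fin 3) L).charpoly.map (algebraMap L (AdeleRing (𝓞 L) L))).map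
        (UnitaryGroup.adeleToLocal L v) := by
  have h := charpoly_eq_of_isConj_units (p.corresponds_toLocal v)
  rw [← Matrix.charpoly_map, ← Matrix.charpoly_map, ← Matrix.charpoly_map]
  exact h.symm

/-- **Componentwise at every finite place `w` of `L`**: `(p_{p.adele}) ↦ L_w` equals `p_{γ₀} ↦ L_w` (the previous lemma at `v := w ∩ L⁺`, read at the factor `w` of
`∏_{w′∣v} L_{w′}`). [cite: Rogawski1990, §14.1 p. 232] -/
theorem MatchingAdeleG.charpoly_map_adeleEval (p : MatchingAdeleG L H γ₀) (w : HeightOneSpectrum (𝓞 L)) :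
    ((p.adele.val : GL (Fin 3) (AdeleRing (𝓞 L) L)) : Matrix (Fin 3) (Fin 3) (AdeleRing (𝓞 L) L)).charpoly.map
        (AdelicGroupData.adeleEval L w) =
      ((γ₀.val : GL (Fin 3) L) : Matrix (Fin 3) (Fin 3) L).charpoly.map (algebraMap L (w.adicCompletion L)) := by
  have hcomp : (Pi.evalRingHom (fun w' : UnitaryGroup.PlacesOver L (w.under (𝓞 ↥(maximalRealSubfield L))) => w'.1.adicCompletion L)
      ⟨w, rfl⟩).comp (UnitaryGroup.adeleToLocal L (w.under (𝓞 ↥(maximalRealSubfield L)))) = AdelicGroupData.adeleEval L w :=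
    RingHom.ext fun x => rfl
  have hcomp₂ : (Pi.evalRingHom (fun w' : UnitaryGroup.PlacesOver L (w.under (𝓞 ↥(maximalRealSubfield L))) => w'.1.adicCompletion L)
      ⟨w, rfl⟩).comp ((UnitaryGroup.adeleToLocal L (w.under (𝓞 ↥(maximalRealSubfield L)))).comp (algebraMap L (AdeleRing (𝓞 L) L))) =
      algebraMap L (w.adicCompletion L) :=
    RingHom.ext fun x => AdeleRing.algebraMap_snd_apply (𝓞 L) L x w
  have h := congrArg (Polynomial.map (Pi.evalRingHom
    (fun w' : UnitaryGroup.PlacesOver L (w.under (𝓞 ↥(maximalRealSubfield L))) => w'.1.adicCompletion L) ⟨w, rfl⟩))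
    (p.charpoly_map_adeleToLocal (w.under (𝓞 ↥(maximalRealSubfield L))))
  simp only [Polynomial.map_map, hcomp, hcomp₂] at h
  exact h

/-- **At infinity**: `(p_{p.adele})_∞ = ι_∞(p_{γ₀})` in `L_∞[X]`, `L_∞ = ∏_{w∣∞} L_w` (★ `MatchingAdeleG.corresponds_arch`: `g_∞` and `γ₀ ⊗ 1` are conjugate in
`GL₃(L ⊗ ℝ)`; pulled back along Mathlib's `InfiniteAdeleRing.ringEquiv_mixedSpace` and `mixedEmbedding_eq_algebraMap_comp`). [cite: Rogawski1990, §14.2 p. 232] -/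
theorem MatchingAdeleG.charpoly_map_fst (p : MatchingAdeleG L H γ₀) :
    ((p.adele.val : GL (Fin 3) (AdeleRing (𝓞 L) L)) : Matrix (Fin 3) (Fin 3) (AdeleRing (𝓞 L) L)).charpoly.map
        (UnitaryGroup.adeleFst L) =
      ((γ₀.val : GL (Fin 3) L) : Matrix (Fin 3) (Fin 3) L).charpoly.map (algebraMap L (InfiniteAdeleRing L)) := by
  have h := charpoly_eq_of_isConj_units p.corresponds_arch
  -- the two matrices of `GL₃(L ⊗ ℝ)`
  have hγ : (((cmRationalToArch L 3 H γ₀ : ↥(UnitaryGroup.arch (↥(maximalRealSubfield L)) L (IsCMField.complexConj L) 3 H)) :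
      GL (Fin 3) (mixedEmbedding.mixedSpace L)) : Matrix (Fin 3) (Fin 3) (mixedEmbedding.mixedSpace L)) =
      ((γ₀.val : GL (Fin 3) L) : Matrix (Fin 3) (Fin 3) L).map (mixedEmbedding L) := by
    rw [coe_cmRationalToArch, UnitaryGroup.coe_rationalToArch]; rfl
  have hp : (((p.arch : ↥(UnitaryGroup.arch (↥(maximalRealSubfield L)) L (IsCMField.complexConj L) 3
      (Matrix.of fun i j : Fin 3 => if i.val + j.val + 1 = 3 then (1 : L) else 0))) :
      GL (Fin 3) (mixedEmbedding.mixedSpace L)) : Matrix (Fin 3) (Fin 3) (mixedEmbedding.mixedSpace L)) =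
      (((p.adele.val : GL (Fin 3) (AdeleRing (𝓞 L) L)) : Matrix (Fin 3) (Fin 3) (AdeleRing (𝓞 L) L)).map
        (UnitaryGroup.adeleFst L)).map
        (InfiniteAdeleRing.ringEquiv_mixedSpace L).toRingHom := by
    rfl
  rw [hγ, hp, Matrix.charpoly_map, Matrix.charpoly_map, Matrix.charpoly_map] at h
  -- `mixedEmbedding = ringEquiv ∘ algebraMap`
  have hme : (mixedEmbedding L : L →+* mixedEmbedding.mixedSpace L) =
      (InfiniteAdeleRing.ringEquiv_mixedSpace L).toRingHom.comp (algebraMap L (InfiniteAdeleRing L)) :=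
    RingHom.ext fun x => InfiniteAdeleRing.mixedEmbedding_eq_algebraMap_comp L (x := x)
  rw [hme, ← Polynomial.map_map] at h
  exact (Polynomial.map_injective _ (InfiniteAdeleRing.ringEquiv_mixedSpace L).injective h).symm

/-- **`ι((p_{γ₀}).coeff k) = (p_{p.adele}).coeff k` in `𝔸_L`** for every matching adèle `p` over `γ₀` and every `k` — the characteristic polynomial of a matching
adèle IS the rational characteristic polynomial of `γ₀`, diagonally embedded (archimedean and finite components by the two previous lemmas).
[cite: Rogawski1990, §3.3 p. 21; §14.1 p. 232] -/
theorem MatchingAdeleG.algebraMap_coeff_charpoly (p : MatchingAdeleG L H γ₀) (k : ℕ) :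
    algebraMap L (AdeleRing (𝓞 L) L) (((γ₀.val : GL (Fin 3) L) : Matrix (Fin 3) (Fin 3) L).charpoly.coeff k) =
      ((p.adele.val : GL (Fin 3) (AdeleRing (𝓞 L) L)) : Matrix (Fin 3) (Fin 3) (AdeleRing (𝓞 L) L)).charpoly.coeff k := by
  refine Prod.ext ?_ ?_
  · -- archimedean components
    have h := congrArg (fun P => Polynomial.coeff P k) p.charpoly_map_fst
    simp only [Polynomial.coeff_map] at h
    exact h.symm
  · -- finite components, place by place
    refine DFunLike.ext _ _ fun w => ?_
    have h := congrArg (fun P => Polynomial.coeff P k) (p.charpoly_map_adeleEval w)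
    simp only [Polynomial.coeff_map, AdelicGroupData.adeleEval_apply] at h
    rw [h]
    exact (AdeleRing.algebraMap_snd_apply (𝓞 L) L _ w).symm ▸ rfl

/-- The `k`-th coefficient of the characteristic polynomial is a continuous function on `U(Φ₃)(𝔸_L)` (★ `continuous_charpoly_coeff` on `M₃(𝔸_L)`).
[cite: HornJohnson2013, Thm 1.2.16] -/
theorem continuous_coeff_charpoly_adelic (J : Matrix (Fin 3) (Fin 3) L) (k : ℕ) :
    Continuous fun g : (UnitaryGroup.cmDatum L 3 J).Adelic =>
      ((g.val : GL (Fin 3) (AdeleRing (𝓞 L) L)) : Matrix (Fin 3) (Fin 3) (AdeleRing (𝓞 L) L)).charpoly.coeff k :=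
  (Literature.LinearAlgebra.Matrix.continuous_charpoly_coeff k).comp (Units.continuous_val.comp continuous_subtype_val)

end Charpoly

/-! ## §3 Finitely many regular stable classes have a matching-adèle class through a compact set -/

section Finite

variable {L : Type} [Field L] [NumberField L] [IsCMField L] {H : Matrix (Fin 3) (Fin 3) L}

omit [IsCMField L] in
/-- **`{ξ ∈ L : ι(ξ) ∈ E}` is finite for compact `E ⊆ 𝔸_L`** — `L` is a discrete (★ `AdeleRing.discreteTopology_principalSubgroup`), hence closed, subgroup of
`𝔸_L`, so `ι(L) ∩ E` is compact and discrete.  (The statement of ★ `AdeleRing.finite_setOf_algebraMap_mem` (`GL2RationalBorelFiniteness`), re-derived here in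
ten lines so that this file does not import the `GL₂` trace-formula modules.) [cite: CasselsFrohlichANT1967, Ch. II §14 Theorem] -/
theorem finite_setOf_algebraMap_mem_of_isCompact {E : Set (AdeleRing (𝓞 L) L)} (hE : IsCompact E) :
    {ξ : L | algebraMap L (AdeleRing (𝓞 L) L) ξ ∈ E}.Finite := by
  haveI : T2Space (AdeleRing (𝓞 L) L) := t2Space_adeleRing_of_numberField L
  haveI := AdeleRing.discreteTopology_principalSubgroup L
  have hcl : IsClosed ((AdeleRing.principalSubgroup (𝓞 L) L : AddSubgroup (AdeleRing (𝓞 L) L)) : Set (AdeleRing (𝓞 L) L)) :=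
    AddSubgroup.isClosed_of_discrete
  have hfin : (Subtype.val ⁻¹' E : Set ↥(AdeleRing.principalSubgroup (𝓞 L) L)).Finite :=
    (hcl.isClosedEmbedding_subtypeVal.isCompact_preimage hE).finite_of_discrete
  have hinj : Set.InjOn (fun ξ : L => (⟨algebraMap L (AdeleRing (𝓞 L) L) ξ, ξ, rfl⟩ : ↥(AdeleRing.principalSubgroup (𝓞 L) L)))
      ((fun ξ : L => (⟨algebraMap L (AdeleRing (𝓞 L) L) ξ, ξ, rfl⟩ : ↥(AdeleRing.principalSubgroup (𝓞 L) L))) ⁻¹'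
        (Subtype.val ⁻¹' E)) :=
    fun a _ b _ h => AdeleRing.algebraMap_injective (𝓞 L) L (congrArg Subtype.val h)
  exact (hfin.preimage hinj).subset fun ξ hξ => hξ

/-- **Only finitely many REGULAR stable classes of `U(H)(L⁺)` have an adelic matching class through a compact `C ⊆ U(Φ₃)(𝔸_L)`** — the G-side half of
ED 1.19c pin (xii-f).  If `g ∈ C` lies in a class of `𝒞_𝐀(γ₀)` then `g` is itself a matching adèle (★ `MatchingAdeleG.conj`), so every coefficient of `p_{γ₀}`
lies in the finite set `{ξ : ι(ξ) ∈ coeff_k(p_·) '' C}` (§2 + `finite_setOf_algebraMap_mem_of_isCompact`); `𝒪 ↦ (coeff_k p_𝒪)_{k < 4}` is injective on the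
regular classes (§1; `p_𝒪` is monic of degree `3`).  No [Kt₄]-fact, no measure, no normalisation. [cite: Rogawski1990, §3.3 p. 21; §5.4 (5.4.3) pp. 72–73]
[cite: Kottwitz1986, §7.3] -/
theorem finite_setOf_stableClass_meets
    {C : Set (UnitaryGroup.cmDatum L 3 (Matrix.of fun i j : Fin 3 => if i.val + j.val + 1 = 3 then (1 : L) else 0)).Adelic} (hC : IsCompact C) :
    {𝒪 : StableClass (cmConjRingHom L) H | ∃ γ₀ : (UnitaryGroup.cmDatum L 3 H).Rational, stableClassOf _ _ γ₀ = 𝒪 ∧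
      IsRegularElt (γ₀.val : GL (Fin 3) L) ∧
        ∃ c ∈ MatchingAdeleG.classes L H γ₀, ∃ g ∈ C, ConjClasses.mk g = c}.Finite := by
  classical
  -- the finite coefficient sets
  set F : ℕ → Set L := fun k => {ξ : L | algebraMap L (AdeleRing (𝓞 L) L) ξ ∈
    (fun g : (UnitaryGroup.cmDatum L 3 (Matrix.of fun i j : Fin 3 => if i.val + j.val + 1 = 3 then (1 : L) else 0)).Adelic =>
      ((g.val : GL (Fin 3) (AdeleRing (𝓞 L) L)) : Matrix (Fin 3) (Fin 3) (AdeleRing (𝓞 L) L)).charpoly.coeff k) '' C} with hF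
  have hFfin : ∀ k, (F k).Finite := fun k =>
    finite_setOf_algebraMap_mem_of_isCompact (hC.image (continuous_coeff_charpoly_adelic _ k))
  -- the coefficient vector of a stable class
  let cv : StableClass (cmConjRingHom L) H → (Fin 4 → L) := fun 𝒪 i => (StableClass.charpoly 𝒪).coeff i
  refine Set.Finite.of_finite_image (f := cv) ((Set.Finite.pi' fun i : Fin 4 => hFfin i).subset ?_) ?_
  · -- the image lies in the finite box `∏_{i<4} F i`
    rintro _ ⟨𝒪, ⟨γ₀, rfl, -, c, hc, g, hgC, hgc⟩, rfl⟩ i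
    obtain ⟨q, hq⟩ := (MatchingAdeleG.mem_classes_iff).1 hc
    have hconj : IsConj q.adele g := ConjClasses.mk_eq_mk_iff_isConj.1 (hq.trans hgc.symm)
    refine ⟨g, hgC, ?_⟩
    show _ = algebraMap L (AdeleRing (𝓞 L) L) ((StableClass.charpoly (stableClassOf (cmConjRingHom L) H γ₀)).coeff i)
    rw [StableClass.charpoly_stableClassOf, (q.conj g hconj).algebraMap_coeff_charpoly i, MatchingAdeleG.adele_conj]
  · -- `cv` is injective on the regular classes
    rintro 𝒪 ⟨γ₀, rfl, hreg, -⟩ 𝒪' ⟨γ₀', rfl, -, -⟩ h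
    refine (stableClassOf_eq_of_charpoly_eq hreg ?_).symm
    have hdeg : ∀ (M : Matrix (Fin 3) (Fin 3) L) (n : ℕ), ¬ n < 4 → M.charpoly.coeff n = 0 := fun M n hn =>
      Polynomial.coeff_eq_zero_of_natDegree_lt (by rw [Matrix.charpoly_natDegree_eq_dim, Fintype.card_fin]; omega)
    ext n
    by_cases hn : n < 4
    · have := congrFun h ⟨n, hn⟩
      simpa only [cv, StableClass.charpoly_stableClassOf] using this.symm
    · rw [hdeg _ n hn, hdeg _ n hn]

end Finite

/-! ## §4 The stable orbital integral of a compactly supported `f` vanishes at all but finitely many regular stable classes -/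

section Support

variable {L : Type} [Field L] [NumberField L] [IsCMField L] {H : Matrix (Fin 3) (Fin 3) L}
  [∀ g : (UnitaryGroup.cmDatum L 3 (Matrix.of fun i j : Fin 3 => if i.val + j.val + 1 = 3 then (1 : L) else 0)).Adelic,
    MeasurableSpace ((UnitaryGroup.cmDatum L 3 (Matrix.of fun i j : Fin 3 => if i.val + j.val + 1 = 3 then (1 : L) else 0)).Adelic ⧸
      Subgroup.centralizer ({g} : Set (UnitaryGroup.cmDatum L 3 (Matrix.of fun i j : Fin 3 => if i.val + j.val + 1 = 3 then (1 : L) else 0)).Adelic))]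

/-- A class that does not meet `tsupport f` has orbital integral `Φ([δ], f) = 0`, for EVERY family `m` (★ `orbitalIntegral_eq_zero_of_forall_notMem_tsupport`;
the ★ `AdelicStableOrbitalSupportFinite` §3 pattern). [cite: Rogawski1990, §4.3 p. 44] -/
theorem classOrbitalIntegral_eq_zero_of_forall_mk_ne
    (m : OrbitalMeasureFamily (UnitaryGroup.cmDatum L 3 (Matrix.of fun i j : Fin 3 => if i.val + j.val + 1 = 3 then (1 : L) else 0)).Adelic)
    {E : Type*} [NormedAddCommGroup E] [NormedSpace ℝ E]
    (f : (UnitaryGroup.cmDatum L 3 (Matrix.of fun i j : Fin 3 => if i.val + j.val + 1 = 3 then (1 : L) else 0)).Adelic → E)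
    {c : ConjClasses (UnitaryGroup.cmDatum L 3 (Matrix.of fun i j : Fin 3 => if i.val + j.val + 1 = 3 then (1 : L) else 0)).Adelic}
    (hc : ∀ g ∈ tsupport f, ConjClasses.mk g ≠ c) : classOrbitalIntegral m f c = 0 := by
  rw [classOrbitalIntegral_eq]
  refine orbitalIntegral_eq_zero_of_forall_notMem_tsupport _ _ fun g hg => hc _ hg ?_
  rw [← ConjClasses.mk_eq_mk_iff_isConj.2 (isConj_iff.2 ⟨g, rfl⟩), ← ConjClasses.quotient_mk_eq_mk, Quotient.out_eq]

/-- **For every family `m` of orbital measures on the adelic classes and every `f` with compact support, `Φ^{st,𝐀}_G(γ₀, m, f) ≠ 0` for only finitely many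
REGULAR stable classes `𝒪_st(γ₀)`** — ED 1.19c pin (xii-f) «`Function.support (𝒪 ↦ SJ_G(𝒪, f))` is finite» on the regular classes: a non-zero `finsum` has a
non-zero term (`exists_ne_zero_of_finsum_mem_ne_zero`), a class with `Φ([δ], f) ≠ 0` meets `tsupport f`, and §3 applies to `C := tsupport f`.
[cite: Rogawski1990, §4.3 p. 44; §5.4 (5.4.3) pp. 72–73] -/
theorem finite_setOf_stableClass_adelicStableOrbitalIntegralG_ne_zero
    (m : OrbitalMeasureFamily (UnitaryGroup.cmDatum L 3 (Matrix.of fun i j : Fin 3 => if i.val + j.val + 1 = 3 then (1 : L) else 0)).Adelic)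
    {f : (UnitaryGroup.cmDatum L 3 (Matrix.of fun i j : Fin 3 => if i.val + j.val + 1 = 3 then (1 : L) else 0)).Adelic → ℂ}
    (hf : HasCompactSupport f) :
    {𝒪 : StableClass (cmConjRingHom L) H | ∃ γ₀ : (UnitaryGroup.cmDatum L 3 H).Rational, stableClassOf _ _ γ₀ = 𝒪 ∧
      IsRegularElt (γ₀.val : GL (Fin 3) L) ∧ adelicStableOrbitalIntegralG L H γ₀ m f ≠ 0}.Finite := by
  refine (finite_setOf_stableClass_meets (H := H) hf.isCompact).subset ?_
  rintro 𝒪 ⟨γ₀, rfl, hreg, hne⟩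
  refine ⟨γ₀, rfl, hreg, ?_⟩
  rw [adelicStableOrbitalIntegralG_def] at hne
  obtain ⟨c, hc, hcne⟩ := exists_ne_zero_of_finsum_mem_ne_zero hne
  by_contra hno
  refine hcne (classOrbitalIntegral_eq_zero_of_forall_mk_ne m f fun g hg hgc => hno ⟨c, hc, g, hg, hgc⟩)

end Support

end Literature.NumberTheory.Rogawski1990

end
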